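import Literature.Probability.RandomPlanarGeometry.HexSAWHopfPath
import HarnessLib

/-!
# Windings of self-avoiding walks from `a` to the boundary of the strip `S_{T,L}`

Topic `Literature/Probability/RandomPlanarGeometry`; third support file (after `HexSAWHopf.lean`,
`HexSAWHopfPath.lean`) for the discharge of
`Literature.Probability.RandomPlanarGeometry.SAW.DuminilCopinSmirnov2012_lemma2` and `…_thm1`.
Source: H. Duminil-Copin, S. Smirnov, *The connective constant of the honeycomb lattice equals
`√(2+√2)`*, Ann. of Math. 175 (2012), 1653–1665 (arXiv:1007.0575), proof of Lemma 2 (p. 5):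
"the winding of any self-avoiding walk from `a` to the bottom part of `α` is `-π` while the
winding to the top part is `π` … the winding from `a` to any half-edge in `β` (resp. `ε` and `ε̄`)
is `0` (resp. `2π/3` and `-2π/3`)", and §3 (the strip `S_{T,L}` and its boundary parts `α`, `β`,
`ε`, `ε̄`, Fig. 3).

## Contents (namespace `Literature.Probability.RandomPlanarGeometry.SAW.HV`; the strip `HV.stripV`,
the walks `HV.IsMidWalk` and the classes `HV.IsAlphaDart/IsBetaDart/IsEpsDart` of `HexSAWStrip`)

* `pturn_of_isBetaDart`: walks `a → β` have total turning `pturn = 0`;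
* `pturn_of_isAlphaDart`: walks `a → α ∖ {a}` have `pturn = ∓3` (`∓π`) according to the side of
  `a` on which they exit (and never exit in the column of `a`);
* `pturn_of_isEpsDart`: walks `a → ε ∪ ε̄` have `pturn = +2` (left cut) / `-2` (right cut);
  all three from Hopf's formula `pturn_walk_eq` of `HexSAWHopfPath` with the rotation `c = 1`,
  `-1`, `-ω`, `ω²` taking the exit direction to `i` (our strip is DCS's rotated by `+π/2`: `α` is
  the bottom, `β` the top);
* `not_mem_stripV_iff_classes`, `boundary_iff`: a half-edge from a vertex of `S_{T,L}` leaves the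
  domain iff it is of class `α`, `β` or `ε ∪ ε̄`, and the classes are disjoint.
-/

noncomputable section

open Finset

namespace Literature.Probability.RandomPlanarGeometry.SAW

namespace HV

open Real Hopf



/-! ### The strip domain: windings to `β`, `α`, `ε ∪ ε̄` -/

section Strip

variable {T L : ℕ} {P : List HV}

/-- The strip domains lie in the upper half-plane. [cite: DuminilCopinSmirnov2012, §3] -/
theorem stripV_upper : ∀ w ∈ stripV T L, 0 ≤ w.2.1 := fun _ hw => (mem_stripV_iff.1 hw).1

/-- Heights in `S_{T,L}` are at most `3T - 1` (in the frame `pos`).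
[cite: DuminilCopinSmirnov2012, §3] -/
theorem pos_snd_le_of_mem_stripV {x : HV} (hx : x ∈ stripV T L) : (pos x).2 ≤ 3 * T - 1 := by
  have h := (mem_stripV_iff.1 hx).2.1
  obtain ⟨a, b, c⟩ := x; cases c <;> simp [pos, lev, bit] at h ⊢ <;> omega

/-- First coordinates in `S_{T,L}` are at most `3L + 2`. [cite: DuminilCopinSmirnov2012, §3] -/
theorem pos_fst_le_of_mem_stripV {x : HV} (hx : x ∈ stripV T L) : (pos x).1 ≤ 3 * L + 2 := by
  have h := (mem_stripV_iff.1 hx).2.2.2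
  obtain ⟨a, b, c⟩ := x; cases c <;> simp [pos] at h ⊢ <;> omega

/-- The left oblique cut: `(pos x).1 + (pos x).2 ≥ -3L + 1` on `S_{T,L}`.
[cite: DuminilCopinSmirnov2012, §3] -/
theorem neg_le_pos_add_of_mem_stripV {x : HV} (hx : x ∈ stripV T L) :
    -(3 * (L : ℤ)) + 1 ≤ (pos x).1 + (pos x).2 := by
  have h := (mem_stripV_iff.1 hx).2.2.1
  obtain ⟨a, b, c⟩ := x; cases c <;> simp [pos, bit] at h ⊢ <;> omega

/-- Quantifying over the entries of a walk list. [folklore] -/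
theorem forall_mem_walk {p : HV → Prop} {l : List HV} {u : HV} (hw : p wOut) (hl : ∀ x ∈ l, p x)
    (hu : p u) : ∀ x ∈ wOut :: (l ++ [u]), p x := by
  intro x hx
  simp only [List.mem_cons, List.mem_append, List.not_mem_nil, or_false] at hx
  rcases hx with rfl | hx | rfl
  exacts [hw, hl x hx, hu]

/-- From an integer multiple of `π/3` to the integer. [folklore] -/
theorem int_eq_of_pi_div_three_mul {n m : ℤ} (h : (π / 3) * n = (π / 3) * m) : n = m := by
  have hπ : (0 : ℝ) < π / 3 := by positivity
  exact_mod_cast (mul_left_cancel₀ hπ.ne' h)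

/-- **Winding to `β` is `0`**: a self-avoiding walk of `S_{T,L}` from `a` to the top boundary `β`
does not turn in total ("the winding from `a` to any half-edge in `β` is `0`").
[cite: DuminilCopinSmirnov2012, proof of Lemma 2] -/
theorem pturn_of_isBetaDart (hP : IsMidWalk (stripV T L) P) (hβ : IsBetaDart T (finalDart P)) :
    pturn P = 0 := by
  rcases hP.trivial_or_exists with rfl | ⟨l, u, hl, rfl⟩
  · rfl
  rw [finalDart_cons_append hl] at hβ
  obtain ⟨h1, h2, h3⟩ := hβ
  dsimp only at h1 h2 h3
  obtain ⟨-, -, -, hlV, -, -⟩ := (isMidWalk_cons_append_iff _ hl u).1 hP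
  set v := l.getLast hl with hv
  have hvV : v ∈ stripV T L := hlV _ (List.getLast_mem hl)
  have hposv : pos v = (3 * v.1 + 2, 3 * v.2.1 + 2) := by simp [pos, h2]
  have hposu : pos u = (3 * v.1 + 1, 3 * v.2.1 + 4) := by
    rw [h3]; simp [pos]; ring
  have key := pturn_walk_eq stripV_upper hl hP ?_ ?_ ?_ one_ne_zero ?_ ?_
  · rw [one_mul, sub_self] at key
    exact int_eq_of_pi_div_three_mul (m := 0) (by rw [key]; simp)
  · rw [mem_stripV_iff, h3]; simp [lev, bit]; omega
  · rw [h3]; simp [wOut]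
  · rw [hposu]; dsimp only; have := (mem_stripV_iff.1 hvV).1; omega
  · refine forall_mem_walk ?_ (fun x hx => ?_) ?_
    · rw [one_mul, emb_im, hposu]; simp only [Prod.snd_sub, pos_wOut]
      have : (0 : ℝ) ≤ ((3 * v.2.1 + 4 - (-1) : ℤ) : ℝ) := by
        have := (mem_stripV_iff.1 hvV).1; exact_mod_cast (by omega)
      positivity
    · rw [one_mul, emb_im, hposu]; simp only [Prod.snd_sub]
      have h4 := pos_snd_le_of_mem_stripV (hlV x hx)
      have : (0 : ℝ) ≤ ((3 * v.2.1 + 4 - (pos x).2 : ℤ) : ℝ) := by exact_mod_cast (by omega)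
      positivity
    · simp [emb]
  · rw [one_mul, hposu, hposv,
      show ((3 * v.1 + 1, 3 * v.2.1 + 4) - (3 * v.1 + 2, 3 * v.2.1 + 2) : ℤ × ℤ) = (-1, 2) by
        simp only [Prod.mk_sub_mk, Prod.mk.injEq]; constructor <;> ring]
    exact arg_emb_neg_one_two

/-- For a walk from `a` to `α` of positive length, the exit column is not the column of `a`
("the only walk from `a` to `a` is the trivial one"). [cite: DuminilCopinSmirnov2012, §3] -/
theorem fst_ne_zero_of_isAlphaDart {V : Finset HV} {l : List HV} {u : HV} (hl : l ≠ [])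
    (hP : IsMidWalk V (wOut :: (l ++ [u]))) (hα : IsAlphaDart (l.getLast hl, u)) :
    (l.getLast hl).1 ≠ 0 := by
  obtain ⟨h1, h2, h3⟩ := hα
  dsimp only at h1 h2 h3
  obtain ⟨-, hh, -, -, hnd, hrev⟩ := (isMidWalk_cons_append_iff _ hl u).1 hP
  intro h0
  have hvO : l.getLast hl = hvOrigin :=
    Prod.ext h0 (Prod.ext h1 h2)
  -- `l` starts and ends at `O`: it is `[O]`
  have hlen : l.length = 1 := by
    have e1 : l[0]'(List.length_pos_of_ne_nil hl) = hvOrigin := by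
      rw [← List.head_eq_getElem hl]
      exact Option.some_injective _ ((List.head?_eq_some_head hl).symm.trans hh)
    have e2 : l[l.length - 1]'(by have := List.length_pos_of_ne_nil hl; omega) = hvOrigin := by
      rw [← List.getLast_eq_getElem hl]; exact hvO
    have := (List.Nodup.getElem_inj_iff hnd).1 (e1.trans e2.symm)
    have := List.length_pos_of_ne_nil hl
    omega
  have hl1 : l = [hvOrigin] := by
    match l, hlen, hh with
    | [a], _, hh => simp only [List.head?_cons, Option.some.injEq] at hh; rw [hh]
  subst hl1
  apply hrev
  rw [h3, hvO]; rfl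

/-- **Winding to `α ∖ {a}` is `∓π`**: a self-avoiding walk of `S_{T,L}` from `a` to the bottom
boundary `α` turns in total by `-π` if it exits to the right of `a` and by `+π` if it exits to
the left ("the winding … to the bottom part of `α` is `-π` while the winding to the top part is
`π`", in DCS's vertical picture). [cite: DuminilCopinSmirnov2012, proof of Lemma 2] -/
theorem pturn_of_isAlphaDart (hP : IsMidWalk (stripV T L) P) (hα : IsAlphaDart (finalDart P)) :
    (finalDart P).1.1 ≠ 0 ∧ pturn P = -(3 * Int.sign (finalDart P).1.1) := by
  rcases hP.trivial_or_exists with rfl | ⟨l, u, hl, rfl⟩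
  · exact absurd hα.1 (by simp [finalDart, wOut])
  rw [finalDart_cons_append hl] at hα ⊢
  have hk := fst_ne_zero_of_isAlphaDart hl hP hα
  obtain ⟨h1, h2, h3⟩ := hα
  dsimp only at h1 h2 h3 hk ⊢
  obtain ⟨-, -, -, hlV, -, -⟩ := (isMidWalk_cons_append_iff _ hl u).1 hP
  set v := l.getLast hl with hv
  set k := v.1 with hkdef
  have hposv : pos v = (3 * k + 1, 1) := by simp [pos, h2, h1, hkdef]
  have hposu : pos u = (3 * k + 2, -1) := by rw [h3]; simp [pos]
  refine ⟨hk, ?_⟩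
  have key := pturn_walk_eq stripV_upper hl hP ?_ ?_ ?_ (neg_ne_zero.2 one_ne_zero) (c := -1)
    ?_ ?_
  · rw [hposu, pos_wOut, show ((3 * k + 2, -1) - (2, -1) : ℤ × ℤ) = (3 * k, 0) by simp,
      show emb (3 * k, 0) = ((3 * k : ℤ) : ℝ) by simp [emb], neg_one_mul, ← Complex.ofReal_neg]
      at key
    apply int_eq_of_pi_div_three_mul
    rw [key]
    rcases lt_or_gt_of_ne hk with hk' | hk'
    · rw [Int.sign_eq_neg_one_of_neg hk',
        Complex.arg_ofReal_of_neg (by exact_mod_cast (by omega)),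
        Complex.arg_ofReal_of_nonneg (by exact_mod_cast (by omega))]
      push_cast; ring
    · rw [Int.sign_eq_one_of_pos hk',
        Complex.arg_ofReal_of_nonneg (by exact_mod_cast (by omega)),
        Complex.arg_ofReal_of_neg (by exact_mod_cast (by omega))]
      push_cast; ring
  · rw [mem_stripV_iff, h3]; simp
  · rw [h3]; simp only [wOut, Ne, Prod.mk.injEq, and_true]; exact hk
  · simp [hposu]
  · refine forall_mem_walk ?_ (fun x hx => ?_) ?_
    · rw [hposu]; simp [emb_im]
    · rw [neg_one_mul, Complex.neg_im, emb_im, hposu]; simp only [Prod.snd_sub]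
      have h4 := one_le_pos_snd (stripV_upper x (hlV x hx))
      have : ((-1 - (pos x).2 : ℤ) : ℝ) ≤ 0 := by exact_mod_cast (by omega)
      have hs : (0 : ℝ) ≤ Real.sqrt 3 / 2 := by positivity
      nlinarith
    · simp [emb]
  · rw [hposu, hposv, show ((3 * k + 2, -1) - (3 * k + 1, 1) : ℤ × ℤ) = -(-1, 2) by
      simp only [Prod.mk_sub_mk, Prod.neg_mk, Prod.mk.injEq]; constructor <;> ring, emb_neg,
      neg_one_mul, neg_neg]
    exact arg_emb_neg_one_two

/-- **Winding to `ε ∪ ε̄` is `±2π/3`**: a self-avoiding walk of `S_{T,L}` from `a` to one of the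
two oblique cuts turns in total by `+2π/3` (left cut) resp. `-2π/3` (right cut) ("the winding …
to `ε` and `ε̄` is `2π/3` and `-2π/3`"). [cite: DuminilCopinSmirnov2012, proof of Lemma 2] -/
theorem pturn_of_isEpsDart (hP : IsMidWalk (stripV T L) P) (hε : IsEpsDart L (finalDart P)) :
    ((finalDart P).2.1 = (finalDart P).1.1 ∧ pturn P = 2) ∨
      ((finalDart P).2.1 = (finalDart P).1.1 + 1 ∧ pturn P = -2) := by
  rcases hP.trivial_or_exists with rfl | ⟨l, u, hl, rfl⟩
  · exfalso
    rcases hε.2 with ⟨-, h⟩ | ⟨-, h⟩ <;> simp [finalDart, wOut, hvOrigin] at h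
  rw [finalDart_cons_append hl] at hε ⊢
  obtain ⟨h2, hε⟩ := hε
  dsimp only at h2 hε ⊢
  obtain ⟨-, -, -, hlV, -, -⟩ := (isMidWalk_cons_append_iff _ hl u).1 hP
  set v := l.getLast hl with hv
  have hvV : v ∈ stripV T L := hlV _ (List.getLast_mem hl)
  have hb := (mem_stripV_iff.1 hvV).1
  have hposv : pos v = (3 * v.1 + 2, 3 * v.2.1 + 2) := by simp [pos, h2]
  rcases hε with ⟨h1, h3⟩ | ⟨h1, h3⟩
  · -- left cut, `c = -ω`
    left
    refine ⟨by rw [h3], ?_⟩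
    have hposu : pos u = (3 * v.1 + 1, 3 * v.2.1 + 1) := by rw [h3]; simp [pos]
    have key := pturn_walk_eq stripV_upper hl hP ?_ ?_ ?_ (neg_ne_zero.2 omg_ne_zero) (c := -omg)
      ?_ ?_
    · apply int_eq_of_pi_div_three_mul
      rw [key, arg_neg_omg_mul]
      · push_cast; ring
      · rw [Ne, emb_eq_zero_iff, hposu, pos_wOut]; simp; omega
      · rw [emb_im, hposu, pos_wOut]; simp only [Prod.snd_sub]
        have : (0 : ℝ) ≤ ((3 * v.2.1 + 1 - (-1) : ℤ) : ℝ) := by exact_mod_cast (by omega)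
        positivity
    · rw [mem_stripV_iff, h3]; simp [bit]; omega
    · rw [h3]; simp [wOut]
    · rw [hposu]; dsimp only; omega
    · have him : ∀ X : ℤ × ℤ, (-omg * emb X).im = (-X.1 - X.2 : ℤ) * (Real.sqrt 3 / 2) := by
        intro X
        rw [show -omg * emb X = -(emb X * omg) by ring, ← emb_rot4, emb_im]; simp [rot4]
      refine forall_mem_walk ?_ (fun x hx => ?_) ?_
      · rw [him, hposu, pos_wOut]; simp only [Prod.fst_sub, Prod.snd_sub]
        have : (0 : ℝ) ≤ ((-(3 * v.1 + 1 - 2) - (3 * v.2.1 + 1 - (-1))) : ℤ) := by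
          exact_mod_cast (by omega)
        positivity
      · rw [him, hposu]; simp only [Prod.fst_sub, Prod.snd_sub]
        have h4 := neg_le_pos_add_of_mem_stripV (hlV x hx)
        have : (0 : ℝ) ≤ ((-(3 * v.1 + 1 - (pos x).1) - (3 * v.2.1 + 1 - (pos x).2)) : ℤ) := by
          exact_mod_cast (by omega)
        positivity
      · rw [sub_self, him]; simp
    · rw [hposu, hposv,
        show ((3 * v.1 + 1, 3 * v.2.1 + 1) - (3 * v.1 + 2, 3 * v.2.1 + 2) : ℤ × ℤ) = (-1, -1) by
          simp only [Prod.mk_sub_mk, Prod.mk.injEq]; constructor <;> ring,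
        show -omg * emb (-1, -1) = -(emb (-1, -1) * omg) by ring, ← emb_rot4]
      exact arg_emb_neg_one_two
  · -- right cut, `c = ω²`
    right
    refine ⟨by rw [h3], ?_⟩
    have hposu : pos u = (3 * v.1 + 4, 3 * v.2.1 + 1) := by
      rw [h3]; simp [pos]; ring
    have key := pturn_walk_eq stripV_upper hl hP ?_ ?_ ?_ (pow_ne_zero 2 omg_ne_zero) (c := omg ^ 2)
      ?_ ?_
    · apply int_eq_of_pi_div_three_mul
      rw [key, arg_omg_sq_mul]
      · push_cast; ring
      · rw [hposu, pos_wOut]; simp only [Prod.fst_sub]; omega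
      · rw [hposu, pos_wOut]; simp only [Prod.snd_sub]; omega
    · rw [mem_stripV_iff, h3]; simp; omega
    · rw [h3]; simp [wOut]
    · rw [hposu]; dsimp only; omega
    · have him : ∀ X : ℤ × ℤ, (omg ^ 2 * emb X).im = (X.1 : ℤ) * (Real.sqrt 3 / 2) := by
        intro X; rw [mul_comm, ← emb_rot2, emb_im]; simp [rot2]
      refine forall_mem_walk ?_ (fun x hx => ?_) ?_
      · rw [him, hposu, pos_wOut]; simp only [Prod.fst_sub]
        have : (0 : ℝ) ≤ ((3 * v.1 + 4 - 2 : ℤ) : ℝ) := by exact_mod_cast (by omega)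
        positivity
      · rw [him, hposu]; simp only [Prod.fst_sub]
        have h4 := pos_fst_le_of_mem_stripV (hlV x hx)
        have : (0 : ℝ) ≤ ((3 * v.1 + 4 - (pos x).1 : ℤ) : ℝ) := by exact_mod_cast (by omega)
        positivity
      · rw [sub_self, him]; simp
    · rw [hposu, hposv,
        show ((3 * v.1 + 4, 3 * v.2.1 + 1) - (3 * v.1 + 2, 3 * v.2.1 + 2) : ℤ × ℤ) = (2, -1) by
          simp only [Prod.mk_sub_mk, Prod.mk.injEq]; constructor <;> ring,
        mul_comm, ← emb_rot2]
      exact arg_emb_neg_one_two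

end Strip


/-! ### Classification of the boundary half-edges of `S_{T,L}` -/

section Classes

variable {T L : ℕ}

/-- **The boundary of `S_{T,L}` is `α ∪ β ∪ ε ∪ ε̄`**: a half-edge from a vertex of `S_{T,L}` leaves
the domain iff it is on `α` (bottom, level `0`, vertical), `β` (top level, vertical) or one of
the two oblique cuts. [cite: DuminilCopinSmirnov2012, §3 (Fig. 3)] -/
theorem not_mem_stripV_iff_classes {v u : HV} (hv : v ∈ stripV T L) (hadj : hvGraph.Adj v u) :
    u ∉ stripV T L ↔ IsAlphaDart (v, u) ∨ IsBetaDart T (v, u) ∨ IsEpsDart L (v, u) := by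
  obtain ⟨a, b, c⟩ := v
  obtain ⟨a', b', c'⟩ := u
  rw [mem_stripV_iff] at hv ⊢
  cases c <;> cases c' <;> simp only [hvGraph_adj, AdjRel] at hadj <;> simp at hadj <;>
    rcases hadj with ⟨rfl, rfl⟩ | ⟨rfl, rfl⟩ | ⟨rfl, rfl⟩ <;>
    simp [IsAlphaDart, IsBetaDart, IsEpsDart, lev, bit] at hv ⊢ <;> omega

/-- The classes `α` and `β` are disjoint. [cite: DuminilCopinSmirnov2012, §3] -/
theorem not_isBetaDart_of_isAlphaDart {d : HV × HV} (h : IsAlphaDart d) : ¬ IsBetaDart T d :=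
  fun h' => by have := h.2.1; rw [h'.2.1] at this; exact Bool.noConfusion this

/-- The classes `α` and `ε ∪ ε̄` are disjoint. [cite: DuminilCopinSmirnov2012, §3] -/
theorem not_isEpsDart_of_isAlphaDart {d : HV × HV} (h : IsAlphaDart d) : ¬ IsEpsDart L d :=
  fun h' => by have := h.2.1; rw [h'.1] at this; exact Bool.noConfusion this

/-- The classes `β` and `ε ∪ ε̄` are disjoint. [cite: DuminilCopinSmirnov2012, §3] -/
theorem not_isEpsDart_of_isBetaDart {d : HV × HV} (h : IsBetaDart T d) : ¬ IsEpsDart L d := by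
  rintro ⟨-, ⟨-, h'⟩ | ⟨-, h'⟩⟩ <;>
  · have := h.2.2; rw [h'] at this; simp only [Prod.mk.injEq] at this; omega

/-- For a walk of `S_{T,L}` from `a`: it is a nontrivial walk to a boundary mid-edge iff its
final half-edge is of class `α`, `β` or `ε ∪ ε̄`. [cite: DuminilCopinSmirnov2012, §3] -/
theorem boundary_iff (hT : 1 ≤ T) {P : List HV} (hP : IsMidWalk (stripV T L) P) :
    (P ≠ [wOut, hvOrigin] ∧ (finalDart P).2 ∉ stripV T L) ↔
      (IsAlphaDart (finalDart P) ∨ IsBetaDart T (finalDart P) ∨ IsEpsDart L (finalDart P)) := by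
  rcases hP.trivial_or_exists with rfl | ⟨l, u, hl, rfl⟩
  · simp only [ne_eq, not_true_eq_false, false_and, finalDart_trivial, false_iff, not_or]
    refine ⟨fun h => ?_, fun h => ?_, fun h => ?_⟩
    · have := h.1; simp [wOut] at this
    · have := h.1; simp [wOut] at this; omega
    · rcases h.2 with ⟨-, h⟩ | ⟨-, h⟩ <;> simp [wOut, hvOrigin] at h
  · obtain ⟨-, -, hadj, hlV, -, -⟩ := (isMidWalk_cons_append_iff _ hl u).1 hP
    rw [finalDart_cons_append hl]
    rw [← not_mem_stripV_iff_classes (hlV _ (List.getLast_mem hl)) hadj]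
    have hne : wOut :: (l ++ [u]) ≠ [wOut, hvOrigin] := by
      intro h
      have := congrArg List.length h
      simp only [List.length_cons, List.length_append, List.length_nil] at this
      exact hl (List.eq_nil_of_length_eq_zero (by omega))
    exact ⟨fun h => h.2, fun h => ⟨hne, h⟩⟩

end Classes
end HV

end Literature.Probability.RandomPlanarGeometry.SAW
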